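import Mathlib
import Summits.Ventures.PercRepro2.Defs
import Summits.Ventures.PercRepro2.CoinTraceBlock
import Summits.Ventures.PercRepro2.CoinTraceShift
import Summits.Ventures.PercRepro2.CoinTwoStarAbstract
import Summits.Ventures.PercRepro2.CoinTraceBlocks

/-!
# The sign method in its general form: a GOOD DECOMPOSITION of the pivotal weight (blind cell
PercRepro2, night-2 g3; proofs/NIGHT2-DARC.md §19.5)

For a pendant set `P ∋ w` and a set `L ⊆ P` of vertices carrying (CU-PA) (leaves, or vertices
whose membership in `K⁻` is a cylinder of pendant coins), the GOOD families are `𝒩_w`,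
`𝒩_w ∪ {P}`, `𝒩_w ∪ {Z ∋ v}` (`v ∈ L`) and `𝒵 = P.powerset`; their blocks are nonnegative
(`CoinTraceBlocks.lean`).  If the pivotal weight decomposes pointwise on the traces of positive
mass as a nonnegative combination of their indicators —
`μ_Z ρ_Z = μ_Z (c₀·1[w ∉ Z] + c_P·1[w ∉ Z ∨ Z = P] + Σ_{v ∈ L} c_v·1[w ∉ Z ∨ v ∈ Z] + c_𝒵)` —
then `S′ = Σ_Z μ_Z ρ_Z (x̂_Z Λ − MX)(ŷ_Z Λ − MY) ≥ 0` (`goodDecomp_functional_nonneg`).  The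
two-vertex heads, the pivotal pairs, the 2-star and the pathstar in its sign-provable regime are
the instances in which such a decomposition exists (their `rho_decomp` lemmas).
-/

namespace Summit.Ventures.PercRepro2.Coin

section GoodDecomp

open Classical

variable {V : Type*} [DecidableEq V] {R : Type*} [Field R] [LinearOrder R] [IsStrictOrderedRing R]

/-- **The sign method, general form.** -/
theorem goodDecomp_functional_nonneg (P : Finset V) {w : V} (hwP : w ∈ P) (L : Finset V)
    (hLP : L ⊆ P) (μ x y xh yh ρ : Finset V → R) (c₀ cP cZ : R) (c : V → R)
    (hμ : ∀ Z ∈ P.powerset, 0 ≤ μ Z)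
    (hx1 : ∀ Z : Finset V, Z ⊆ P → x Z ≤ 1) (hy1 : ∀ Z : Finset V, Z ⊆ P → y Z ≤ 1)
    (hxh1 : ∀ Z : Finset V, Z ⊆ P → xh Z ≤ 1) (hyh1 : ∀ Z : Finset V, Z ⊆ P → yh Z ≤ 1)
    (hxanti : ∀ Z Z' : Finset V, Z ⊆ Z' → Z' ⊆ P → x Z' ≤ x Z)
    (hyanti : ∀ Z Z' : Finset V, Z ⊆ Z' → Z' ⊆ P → y Z' ≤ y Z)
    (hxhanti : ∀ Z Z' : Finset V, Z ⊆ Z' → Z' ⊆ P → xh Z' ≤ xh Z)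
    (hyhanti : ∀ Z Z' : Finset V, Z ⊆ Z' → Z' ⊆ P → yh Z' ≤ yh Z)
    (hxh_le : ∀ Z : Finset V, Z ⊆ P → xh Z ≤ x Z) (hyh_le : ∀ Z : Finset V, Z ⊆ P → yh Z ≤ y Z)
    (hxh_eq : ∀ Z : Finset V, Z ⊆ P → w ∉ Z → xh Z = x Z)
    (hyh_eq : ∀ Z : Finset V, Z ⊆ P → w ∉ Z → yh Z = y Z)
    (hc₀ : 0 ≤ c₀) (hcP : 0 ≤ cP) (hcZ : 0 ≤ cZ) (hc : ∀ v ∈ L, 0 ≤ c v)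
    (hdecomp : ∀ Z ∈ P.powerset, μ Z * ρ Z =
      μ Z * (c₀ * (if Disjoint Z {w} then (1 : R) else 0)
        + cP * (if Disjoint Z {w} ∨ Z = P then (1 : R) else 0)
        + ∑ v ∈ L, c v * (if Disjoint Z {w} ∨ v ∈ Z then (1 : R) else 0) + cZ))
    (hPA : TracePA P μ) (hCU : ∀ v ∈ L, TraceCUPA P μ v) :
    0 ≤ ∑ Z ∈ P.powerset, μ Z * ρ Z *
      (xh Z * (∑ Z' ∈ P.powerset, μ Z') - ∑ Z' ∈ P.powerset, x Z' * μ Z') *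
      (yh Z * (∑ Z' ∈ P.powerset, μ Z') - ∑ Z' ∈ P.powerset, y Z' * μ Z') := by
  obtain ⟨Λ, hΛ⟩ : ∃ L : R, L = ∑ Z ∈ P.powerset, μ Z := ⟨_, rfl⟩
  obtain ⟨MX, hMX⟩ : ∃ M : R, M = ∑ Z ∈ P.powerset, x Z * μ Z := ⟨_, rfl⟩
  obtain ⟨MY, hMY⟩ : ∃ M : R, M = ∑ Z ∈ P.powerset, y Z * μ Z := ⟨_, rfl⟩
  have hA := avoid_block_nonneg P hwP μ x y xh yh hμ hx1 hy1 hxh1 hyh1 hxanti hyanti hxhanti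
    hyhanti hxh_eq hyh_eq hPA
  have hT := top_block_nonneg P hwP μ x y xh yh hμ hx1 hy1 hxh1 hyh1 hxanti hyanti hxhanti
    hyhanti hxh_le hyh_le hxh_eq hyh_eq hPA
  have hC : ∀ v ∈ L, 0 ≤ ∑ Z ∈ P.powerset.filter (fun Z => Disjoint Z {w} ∨ v ∈ Z),
      μ Z * (xh Z * (∑ Z' ∈ P.powerset, μ Z') - ∑ Z' ∈ P.powerset, x Z' * μ Z') *
        (yh Z * (∑ Z' ∈ P.powerset, μ Z') - ∑ Z' ∈ P.powerset, y Z' * μ Z') :=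
    fun v hv => cylinder_block_nonneg P hwP (hLP hv) μ x y xh yh hμ hx1 hy1 hxh1 hyh1 hxanti
      hyanti hxhanti hyhanti hxh_le hyh_le hxh_eq hyh_eq hPA (hCU v hv)
  have hD := all_block_nonneg P μ x y xh yh hμ hxh1 hyh1 hxhanti hyhanti hxh_le hyh_le hPA
  rw [← hΛ, ← hMX, ← hMY] at hA hT hC hD ⊢
  -- the decomposition of the sum
  have hdec : ∑ Z ∈ P.powerset, μ Z * ρ Z * (xh Z * Λ - MX) * (yh Z * Λ - MY) =
      c₀ * ∑ Z ∈ P.powerset.filter (fun Z => Disjoint Z {w}),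
          μ Z * (xh Z * Λ - MX) * (yh Z * Λ - MY)
      + cP * ∑ Z ∈ P.powerset.filter (fun Z => Disjoint Z {w} ∨ Z = P),
          μ Z * (xh Z * Λ - MX) * (yh Z * Λ - MY)
      + ∑ v ∈ L, c v * ∑ Z ∈ P.powerset.filter (fun Z => Disjoint Z {w} ∨ v ∈ Z),
          μ Z * (xh Z * Λ - MX) * (yh Z * Λ - MY)
      + cZ * ∑ Z ∈ P.powerset, μ Z * (xh Z * Λ - MX) * (yh Z * Λ - MY) := by
    have e : ∀ Z ∈ P.powerset, μ Z * ρ Z * (xh Z * Λ - MX) * (yh Z * Λ - MY) =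
        c₀ * ((if Disjoint Z {w} then (1 : R) else 0) *
            (μ Z * (xh Z * Λ - MX) * (yh Z * Λ - MY)))
        + cP * ((if Disjoint Z {w} ∨ Z = P then (1 : R) else 0) *
            (μ Z * (xh Z * Λ - MX) * (yh Z * Λ - MY)))
        + (∑ v ∈ L, c v * ((if Disjoint Z {w} ∨ v ∈ Z then (1 : R) else 0) *
            (μ Z * (xh Z * Λ - MX) * (yh Z * Λ - MY))))
        + cZ * (μ Z * (xh Z * Λ - MX) * (yh Z * Λ - MY)) := by
      intro Z hZ
      have es : ∑ v ∈ L, c v * ((if Disjoint Z {w} ∨ v ∈ Z then (1 : R) else 0) *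
          (μ Z * (xh Z * Λ - MX) * (yh Z * Λ - MY))) =
          (∑ v ∈ L, c v * (if Disjoint Z {w} ∨ v ∈ Z then (1 : R) else 0)) *
            (μ Z * (xh Z * Λ - MX) * (yh Z * Λ - MY)) := by
        rw [Finset.sum_mul]
        exact Finset.sum_congr rfl fun v _ => by ring
      rw [es, show μ Z * ρ Z * (xh Z * Λ - MX) * (yh Z * Λ - MY) =
        (μ Z * ρ Z) * ((xh Z * Λ - MX) * (yh Z * Λ - MY)) by ring, hdecomp Z hZ]
      ring
    rw [Finset.sum_congr rfl e, Finset.sum_add_distrib, Finset.sum_add_distrib,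
      Finset.sum_add_distrib, ← Finset.mul_sum, ← Finset.mul_sum, ← Finset.mul_sum,
      sum_ite_mul_eq_sum_filter, sum_ite_mul_eq_sum_filter, Finset.sum_comm]
    congr 2
    refine Finset.sum_congr rfl fun v _ => ?_
    rw [← Finset.mul_sum, sum_ite_mul_eq_sum_filter]
  rw [hdec]
  refine add_nonneg (add_nonneg (add_nonneg (mul_nonneg hc₀ hA) (mul_nonneg hcP hT)) ?_)
    (mul_nonneg hcZ hD)
  exact Finset.sum_nonneg fun v hv => mul_nonneg (hc v hv) (hC v hv)

end GoodDecomp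

end Summit.Ventures.PercRepro2.Coin
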